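import Summits.AnomalousDissipation.AnomalousDissipation.Theorems.SawtoothPulseCascadeK3LocalisedClosureApproxBookkeeping
import Summits.AnomalousDissipation.AnomalousDissipation.Theorems.SawtoothPulseCascadeK3LocalisedClosureApproxResponse
import Summits.AnomalousDissipation.AnomalousDissipation.Theorems.SawtoothPulseCascadeLipAgmonEnvelopeMainP
import Summits.AnomalousDissipation.AnomalousDissipation.Theorems.SawtoothPulseCascadeLipAgmonCaps

/-!
# `ApproximateSolution ⟨γ, δ₀, 2, 1, 2⟩ (γ²−3)` from `K2″` at the same point — SYMBOLIC corner rounding `δ₀`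
(route `AnomalousDissipation/SawtoothPulseCascade`; helper for the crux K1loc = stmt-AnomalousDissipation-19491,
δ₀-generalisation of the pointwise closure K1loc ∧ K2 → Target — ROUND-18 §D.2 of the K1loc arbiter)

The landed composition `LipAgmon.approximateSolution_two` (line `lip-agmon`) at the box point `⟨γ, 1/4, 2, 1, 2⟩`, re-run
at `⟨γ, δ₀, 2, 1, 2⟩` with `0 < δ₀`: S1 = `ApproxResponse.responseL2EnvelopeP` (the `L²` envelope, constant
`K ∝ γ/δ₀`), S2 = `lipEnvelope_of_caps_P` + `caps_H` / `caps_V`, S3 = `DriftFreeApprox.envelopeBookkeeping`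
(unchanged: the carrier rates `rateH`, `rateV` do not depend on `δ₀`), assembled by
`DriftFreeApprox.approximateSolution_of_envelopes` on the classical response of `DriftFreeApprox.exists_linearisedResponse`.
Main theorem `approximateSolution_P : γ ∈ [5,8] → 0 < δ₀ → K2PhaseGrowthClassical ⟨γ,δ₀,2,1,2⟩ 3 →
ApproximateSolution ⟨γ,δ₀,2,1,2⟩ (γ²−3)`.
-/

set_option linter.dupNamespace false

noncomputable section

namespace Summit.AnomalousDissipation.AnomalousDissipation.Theorems.SawtoothPulseCascade.LipAgmon

open Set MeasureTheory
open scoped InnerProductSpace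
open Literature.Analysis Literature.Analysis.FunctionSpaces Literature.Analysis.FluidPDE
open Literature.Analysis.FluidPDE.SawtoothCascade
open Literature.Analysis.FluidPDE.SawtoothCascade.DriftFree
open Summit.AnomalousDissipation.AnomalousDissipation.Theorems.SawtoothPulseCascade

/-- `K2″` at `⟨γ, δ₀, 2, 1, 2⟩` plus a geometric continuous Lipschitz envelope of the classical linearised response
with ratio `M₁ < (γ²−3)²` give `DriftFree.ApproximateSolution ⟨γ,δ₀,2,1,2⟩ (γ²−3)`, `γ ∈ [5,8]`, `0 < δ₀`
(the landed `approximateSolution_two_of_lipEnvelope` with `1/4 ↦ δ₀`; `envelopeBookkeeping` is reused verbatim since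
`rateH`, `rateV` depend on `γ` only): compose the
`L²` envelope (`ApproxResponse.responseL2Envelope`), the bookkeeping of the two smallness integrals
(`DriftFreeApprox.envelopeBookkeeping`) and `DriftFreeApprox.approximateSolution_of_envelopes` on the
classical response produced by `DriftFreeApprox.exists_linearisedResponse`. [folklore] -/
theorem approximateSolution_of_lipEnvelope_P {γ : ℝ} (hγ : γ ∈ Set.Icc (5 : ℝ) 8) {δ₀ : ℝ} (hδ₀ : 0 < δ₀)
    (hK2 : Literature.Analysis.FluidPDE.SawtoothCascade.K2PhaseGrowthClassical ⟨γ, δ₀, 2, 1, 2⟩ 3)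
    (h2 :
      ∃ M₁ K : ℝ, 0 ≤ M₁ ∧ M₁ < (γ ^ 2 - 3) ^ 2 ∧ 0 ≤ K ∧
      ∀ A : ℕ, ∃ ν₀ : ℝ, 0 < ν₀ ∧ ∀ ν ∈ Set.Ioc 0 ν₀, ∀ T' : ℝ,
        horizon (γ ^ 2 - 3) ν A < T' → T' < 1 →
        ∀ (L : ℝ → UnitAddTorus (Fin 2) → EuclideanSpace ℝ (Fin 2)) (q : ℝ → UnitAddTorus (Fin 2) → ℝ),
          Torus.IsSmoothSpaceTimeOn (Icc 0 T') L → Torus.IsSmoothSpaceTimeOn (Icc 0 T') q →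
          (∀ t ∈ Icc 0 T', Torus.IsDivFree (L t)) → L 0 = 0 →
          (∀ t ∈ Icc 0 T', ∀ x, Torus.timeDerivWithin (Icc 0 T') L t x +
            Torus.convect ((⟨γ, δ₀, 2, 1, 2⟩ : CascadeParams).field t) (L t) x +
            Torus.convect (L t) ((⟨γ, δ₀, 2, 1, 2⟩ : CascadeParams).field t) x =
              ν • Torus.laplacian (L t) x - Torus.gradient (q t) x +
                ν • Torus.laplacian ((⟨γ, δ₀, 2, 1, 2⟩ : CascadeParams).field t) x) →
          ∃ Λ : ℝ → ℝ,
            ContinuousOn Λ (Icc 0 (horizon (γ ^ 2 - 3) ν A)) ∧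
            (∀ t ∈ Icc 0 (horizon (γ ^ 2 - 3) ν A), ∀ x : UnitAddTorus (Fin 2),
              ‖Torus.fderiv (L t) x‖ ≤ Λ t) ∧
            ∀ j : ℕ, ∀ t ∈ Icc 0 (horizon (γ ^ 2 - 3) ν A),
              t ∈ Icc (CascadeParams.tStart j) (CascadeParams.tStart (j + 1)) →
              Λ t ≤ K * ν * ((j : ℝ) + 1) * M₁ ^ (j + 1)) :
    ApproximateSolution ⟨γ, δ₀, 2, 1, 2⟩ (γ ^ 2 - 3) := by
  have hγ0 : (0 : ℝ) ≤ γ := le_trans (by norm_num) hγ.1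
  have hρN : (2 : ℕ) ∈ Finset.Icc 2 7 := Finset.mem_Icc.2 ⟨le_rfl, by norm_num⟩
  obtain ⟨M₂, K₂, hM₂0, hM₂, hK₂0, H1⟩ := ApproxResponse.responseL2EnvelopeP hγ hδ₀ hρN hK2
  obtain ⟨M₁, K₁, hM₁0, hM₁, hK₁0, H2⟩ := h2
  refine DriftFreeApprox.approximateSolution_of_envelopes ⟨γ, δ₀, 2, 1, 2⟩ hγ0 hδ₀ (by norm_num) ?_
  intro A ε hε
  obtain ⟨ν₁, hν₁, H1A⟩ := H1 A
  obtain ⟨ν₂, hν₂, H2A⟩ := H2 A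
  obtain ⟨ν₃, hν₃, H3A⟩ :=
    DriftFreeApprox.envelopeBookkeeping γ hγ 2 hρN M₁ M₂ K₁ K₂ hM₁0 hM₁ hM₂0 hM₂ hK₁0 hK₂0 A ε hε
  refine ⟨min ν₁ (min ν₂ ν₃), lt_min hν₁ (lt_min hν₂ hν₃), fun ν hν => ?_⟩
  have hn1 : ν ∈ Set.Ioc 0 ν₁ := ⟨hν.1, hν.2.trans (min_le_left _ _)⟩
  have hn2 : ν ∈ Set.Ioc 0 ν₂ := ⟨hν.1, (hν.2.trans (min_le_right _ _)).trans (min_le_left _ _)⟩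
  have hn3 : ν ∈ Set.Ioc 0 ν₃ := ⟨hν.1, (hν.2.trans (min_le_right _ _)).trans (min_le_right _ _)⟩
  set T := horizon (γ ^ 2 - 3) ν A with hT
  have hT0 : 0 ≤ T := CascadeParams.tStart_nonneg _
  have hT1 : T < 1 := CascadeParams.tStart_lt_one _
  set T' : ℝ := (T + 1) / 2 with hT'
  have hTT' : T < T' := by rw [hT']; linarith
  have hT'1 : T' < 1 := by rw [hT']; linarith
  have hT'0 : 0 < T' := hT0.trans_lt hTT'
  obtain ⟨L, q, hL, hq, hdiv, hL0, hlin⟩ :=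
    DriftFreeApprox.exists_linearisedResponse ⟨γ, δ₀, 2, 1, 2⟩ hδ₀ (by norm_num) hν.1 hT'0 hT'1
  obtain ⟨Λ, hΛc, hΛ, hΛle⟩ := H2A ν hn2 T' hTT' hT'1 L q hL hq hdiv hL0 hlin
  have hEle := H1A ν hn1 T' hTT' hT'1 L q hL hq hdiv hL0 hlin
  set E : ℝ → ℝ := fun t => Real.sqrt (FluidPDE.Torus.vectorL2Sq (L t)) with hE
  have hEc : ContinuousOn E (Set.Icc 0 T) := by
    have h := (hL.continuousOn_integral_norm_sq (convex_Icc 0 T')).mono (Set.Icc_subset_Icc le_rfl hTT'.le)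
    exact (Real.continuous_sqrt.comp_continuousOn h).congr fun s _ => rfl
  have henv : ∀ j : ℕ, ∀ t ∈ Set.Icc 0 T, t ∈ Set.Icc (CascadeParams.tStart j) (CascadeParams.tStart (j + 1)) →
      0 ≤ E t ∧ E t ≤ K₂ * ν * ((j : ℝ) + 1) * M₂ ^ (j + 1) ∧
      0 ≤ Λ t ∧ Λ t ≤ K₁ * ν * ((j : ℝ) + 1) * M₁ ^ (j + 1) :=
    fun j t ht hj => ⟨Real.sqrt_nonneg _, hEle j t ht hj, (norm_nonneg _).trans (hΛ t ht 0), hΛle j t ht hj⟩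
  obtain ⟨hint, hdef⟩ := H3A ν hn3 E Λ hEc hΛc henv
  exact ⟨T', hTT', hT'1, L, q, E, Λ, hL, hq, hdiv, hL0, hlin, fun t _ => le_rfl, hΛ, hEc, hΛc, hint, hdef⟩

/-- **S2″ at corner rounding `δ₀` — the Lipschitz envelope at `ρN = 2` from `K2″` alone**: `lipEnvelope_of_caps_P`
with the profile slot caps supplied by `caps_H`, `caps_V` (valid for every parameter point).
[cite: MajdaBertozzi2002, §3.2 Prop. 3.7 (energy estimates for derivatives, uniform in the viscosity)] -/
theorem lipEnvelope_P {γ : ℝ} (hγ : γ ∈ Icc (5 : ℝ) 8) {δ₀ : ℝ} (hδ₀ : 0 < δ₀)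
    (hK2 : Literature.Analysis.FluidPDE.SawtoothCascade.K2PhaseGrowthClassical ⟨γ, δ₀, 2, 1, 2⟩ 3) :
    ∃ M₁ K : ℝ, 0 ≤ M₁ ∧ M₁ < (γ ^ 2 - 3) ^ 2 ∧ 0 ≤ K ∧
      ∀ A : ℕ, ∃ ν₀ : ℝ, 0 < ν₀ ∧ ∀ ν ∈ Set.Ioc 0 ν₀, ∀ T' : ℝ,
        horizon (γ ^ 2 - 3) ν A < T' → T' < 1 →
        ∀ (L : ℝ → UnitAddTorus (Fin 2) → EuclideanSpace ℝ (Fin 2)) (q : ℝ → UnitAddTorus (Fin 2) → ℝ),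
          Torus.IsSmoothSpaceTimeOn (Icc 0 T') L → Torus.IsSmoothSpaceTimeOn (Icc 0 T') q →
          (∀ t ∈ Icc 0 T', Torus.IsDivFree (L t)) → L 0 = 0 →
          (∀ t ∈ Icc 0 T', ∀ x, Torus.timeDerivWithin (Icc 0 T') L t x +
            Torus.convect ((⟨γ, δ₀, 2, 1, 2⟩ : CascadeParams).field t) (L t) x +
            Torus.convect (L t) ((⟨γ, δ₀, 2, 1, 2⟩ : CascadeParams).field t) x =
              ν • Torus.laplacian (L t) x - Torus.gradient (q t) x +
                ν • Torus.laplacian ((⟨γ, δ₀, 2, 1, 2⟩ : CascadeParams).field t) x) →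
          ∃ Λ : ℝ → ℝ,
            ContinuousOn Λ (Icc 0 (horizon (γ ^ 2 - 3) ν A)) ∧
            (∀ t ∈ Icc 0 (horizon (γ ^ 2 - 3) ν A), ∀ x : UnitAddTorus (Fin 2),
              ‖Torus.fderiv (L t) x‖ ≤ Λ t) ∧
            ∀ j : ℕ, ∀ t ∈ Icc 0 (horizon (γ ^ 2 - 3) ν A),
              t ∈ Icc (CascadeParams.tStart j) (CascadeParams.tStart (j + 1)) →
              Λ t ≤ K * ν * ((j : ℝ) + 1) * M₁ ^ (j + 1) := by
  have hγ0 : (0 : ℝ) ≤ γ := le_trans (by norm_num) hγ.1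
  exact lipEnvelope_of_caps_P hγ hδ₀ (c₃ := 8 * Real.pi ^ 2) (c₄ := 80 * Real.pi ^ 3 / Real.sqrt (2 * Real.pi))
    (c₅ := 192 * Real.pi ^ 4) (by positivity) (by positivity) (by positivity)
    (fun ν j => caps_H ⟨γ, δ₀, 2, 1, 2⟩ hγ0 hδ₀ (by norm_num) ν j)
    (fun ν j => caps_V ⟨γ, δ₀, 2, 1, 2⟩ hγ0 hδ₀ (by norm_num) ν j) hK2

/-- **`K2″` at `⟨γ, δ₀, 2, 1, 2⟩` gives `DriftFree.ApproximateSolution ⟨γ,δ₀,2,1,2⟩ (γ²−3)` for every `γ ∈ [5,8]` and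
every corner rounding `δ₀ > 0`** — unconditionally: `approximateSolution_of_lipEnvelope_P` + `lipEnvelope_P`.  This is
the `ApproxSol` input of the δ₀-symbolic pointwise closure (shape P of the K1loc restatement). [folklore] -/
theorem approximateSolution_P {γ : ℝ} (hγ : γ ∈ Icc (5 : ℝ) 8) {δ₀ : ℝ} (hδ₀ : 0 < δ₀)
    (hK2 : Literature.Analysis.FluidPDE.SawtoothCascade.K2PhaseGrowthClassical ⟨γ, δ₀, 2, 1, 2⟩ 3) :
    ApproximateSolution ⟨γ, δ₀, 2, 1, 2⟩ (γ ^ 2 - 3) :=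
  approximateSolution_of_lipEnvelope_P hγ hδ₀ hK2 (lipEnvelope_P hγ hδ₀ hK2)
end Summit.AnomalousDissipation.AnomalousDissipation.Theorems.SawtoothPulseCascade.LipAgmon

end
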